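import Mathlib.MeasureTheory.Constructions.HaarToSphere
import Mathlib.MeasureTheory.Integral.Pi
import Mathlib.Analysis.SpecialFunctions.ImproperIntegrals
import Mathlib.Analysis.SpecialFunctions.Integrals.Basic
import Mathlib.MeasureTheory.Measure.Lebesgue.Basic
import HarnessLib

/-!
# Three explicit integrals on `ℝ^d` and on the cube `[-π,π]^d`

Support file for the proof of Liu–Slade's comparison
`S_1 = δ + C_1/σ² + O(L^{-(1-ε)}⟦x⟧^{-(d-1)})` (Liu–Slade 2026, Prop. 1.2, (1.9)). The `L`-dependence
of the `L¹(𝕋^d)`-norm of `∂_l^{d-1}` of the (regularised) symbol `1/(1 - μD̂) - λ/(1 - νD̂_nn)` is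
read off from three integrals, computed or bounded here with explicit constants (sup norm `‖k‖` on
`ℝ^d = Fin d → ℝ`, Lebesgue measure):

* `integral_norm_pow_inv_ball` — `∫_{‖k‖ ≤ r} ‖k‖^{-(d-1)} dk = d 2^d r` (the small ball; in the
  application `r = 1/L`);
* `integral_norm_pow_inv_annulus` — `∫_{‖k‖ ≥ r} ‖k‖^{-(d+1)} dk = d 2^d / r`;
* `integral_cube_dirichletMajorant_le` — for the Dirichlet-kernel majorant
  `M_L(k) = Π_j π/max(π, L|k_j|)` (`dirichletMajorant`): `∫_{[-π,π]^d} M_L ≤ ((2π/L)(1 + log L))^d`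
  (`L ≥ 1`), through `∫_{-π}^{π} π/max(π, L|t|) dt = (2π/L)(1 + log L)`.

The first two are polar coordinates (`MeasureTheory.integral_fun_norm_addHaar`, unit ball of
volume `2^d`), the third is Fubini for a product (`MeasureTheory.integral_fintype_prod_eq_prod`).
These are the integrals `‖ |k|^{-|α|} 1_{B_L} ‖_1`, `‖ |k|^{-2-|α|} ‖_{L¹(B_L^c)}` and
`‖D̂_α‖_q ≲ L^{|α| - d/q}` of the printed proof in their `q = 1` (logarithmic) form.

## References

* Y. Liu, G. Slade, *Gaussian deconvolution and the lace expansion for spread-out models*,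
  Ann. Inst. H. Poincaré Probab. Statist. (2026), arXiv:2310.07640: App. A (proof of Lemma 5.1)
  and App. B (proof of (3.15): the `L^q` norms of `D̂_α` through the Dirichlet kernel,
  `∫_{1/L}^{π} t^{-q} dt`) [LiuSlade2026].
-/

noncomputable section

namespace Literature.Barriers.CriticalPhenomena

open MeasureTheory Set Filter Real
open scoped Topology BigOperators Real

variable {d : ℕ}

/-! ## Polar coordinates in the sup norm -/

/-- **Polar coordinates on `(ℝ^d, ‖·‖_∞)`**: `∫ f(‖k‖) dk = d 2^d ∫_0^∞ y^{d-1} f(y) dy` (`d ≥ 1`;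
the unit ball of the sup norm has volume `2^d`). [folklore] -/
theorem integral_fun_norm_pi (hd : 1 ≤ d) (f : ℝ → ℝ) :
    ∫ k : Fin d → ℝ, f ‖k‖ = d * 2 ^ d * ∫ y in Ioi (0 : ℝ), y ^ (d - 1) * f y := by
  haveI : Nonempty (Fin d) := ⟨⟨0, hd⟩⟩
  haveI : Nontrivial (Fin d → ℝ) := Function.nontrivial
  have h := integral_fun_norm_addHaar (volume : Measure (Fin d → ℝ)) f
  rw [h, Module.finrank_fin_fun, measureReal_def, Real.volume_pi_ball 0 one_pos,
    Fintype.card_fin, ENNReal.toReal_ofReal (by positivity), nsmul_eq_mul, smul_eq_mul]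
  simp only [smul_eq_mul, mul_one]
  ring

/-- Integrability in polar coordinates: `f(‖k‖) ∈ L¹(ℝ^d)` iff `y^{d-1} f(y) ∈ L¹(0,∞)` (`d ≥ 1`).
[folklore] -/
theorem integrable_fun_norm_pi (hd : 1 ≤ d) (f : ℝ → ℝ) :
    Integrable (fun k : Fin d → ℝ => f ‖k‖) ↔
      IntegrableOn (fun y : ℝ => y ^ (d - 1) * f y) (Ioi 0) := by
  haveI : Nonempty (Fin d) := ⟨⟨0, hd⟩⟩
  haveI : Nontrivial (Fin d → ℝ) := Function.nontrivial
  have h := integrable_fun_norm_addHaar (volume : Measure (Fin d → ℝ)) (f := f)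
  rw [Module.finrank_fin_fun] at h
  simpa only [smul_eq_mul] using h

/-! ## The small ball: `∫_{‖k‖ ≤ r} ‖k‖^{-(d-1)}` -/

/-- The radial profile of the small-ball integrand. [folklore] -/
def ballProfile (d : ℕ) (r y : ℝ) : ℝ := if y ≤ r then (y ^ (d - 1))⁻¹ else 0

/-- On `(0,∞)`, `y^{d-1} · ballProfile = 1_{(0,r]}`. [folklore] -/
theorem pow_mul_ballProfile {r y : ℝ} (hy : 0 < y) :
    y ^ (d - 1) * ballProfile d r y = (Iic r).indicator (fun _ => (1 : ℝ)) y := by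
  unfold ballProfile
  by_cases h : y ≤ r
  · rw [if_pos h, indicator_of_mem (mem_Iic.2 h), mul_inv_cancel₀ (pow_ne_zero _ hy.ne')]
  · rw [if_neg h, indicator_of_notMem (fun h' => h (mem_Iic.1 h')), mul_zero]

/-- `y^{d-1} · ballProfile ∈ L¹(0,∞)`. [folklore] -/
theorem integrableOn_pow_mul_ballProfile (d : ℕ) (r : ℝ) :
    IntegrableOn (fun y : ℝ => y ^ (d - 1) * ballProfile d r y) (Ioi 0) := by
  have h : IntegrableOn (fun y : ℝ => (Iic r).indicator (fun _ => (1 : ℝ)) y) (Ioi 0) := by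
    rw [IntegrableOn, integrable_indicator_iff measurableSet_Iic, IntegrableOn,
      Measure.restrict_restrict measurableSet_Iic, Iic_inter_Ioi]
    exact integrableOn_const (by rw [Real.volume_Ioc]; exact ENNReal.ofReal_lt_top |>.ne)
  exact h.congr_fun (fun y hy => (pow_mul_ballProfile (mem_Ioi.1 hy)).symm) measurableSet_Ioi

/-- **The small ball**: `∫_{‖k‖ ≤ r} ‖k‖^{-(d-1)} dk = d 2^d r` (`d ≥ 1`, `r > 0`). [folklore] -/
theorem integral_norm_pow_inv_ball (hd : 1 ≤ d) {r : ℝ} (hr : 0 < r) :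
    ∫ k : Fin d → ℝ, ballProfile d r ‖k‖ = d * 2 ^ d * r := by
  rw [integral_fun_norm_pi hd]
  congr 1
  rw [setIntegral_congr_fun measurableSet_Ioi (fun y hy => pow_mul_ballProfile (mem_Ioi.1 hy)),
    integral_indicator measurableSet_Iic, Measure.restrict_restrict measurableSet_Iic, Iic_inter_Ioi,
    setIntegral_const, Real.volume_real_Ioc_of_le hr.le, smul_eq_mul, mul_one, sub_zero]

/-- Integrability of the small-ball integrand. [folklore] -/
theorem integrable_ballProfile_norm (hd : 1 ≤ d) (r : ℝ) :
    Integrable fun k : Fin d → ℝ => ballProfile d r ‖k‖ :=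
  (integrable_fun_norm_pi hd _).2 (integrableOn_pow_mul_ballProfile d r)

/-- The small-ball integrand is nonnegative. [folklore] -/
theorem ballProfile_nonneg (d : ℕ) (r : ℝ) {y : ℝ} (hy : 0 ≤ y) : 0 ≤ ballProfile d r y := by
  unfold ballProfile; split_ifs <;> positivity

/-! ## The annulus: `∫_{‖k‖ ≥ r} ‖k‖^{-(d+1)}` -/

/-- The radial profile of the annulus integrand. [folklore] -/
def annulusProfile (d : ℕ) (r y : ℝ) : ℝ := if r ≤ y then (y ^ (d + 1))⁻¹ else 0

/-- On `(0,∞)`, `y^{d-1} · annulusProfile = 1_{[r,∞)} y^{-2}` (`d ≥ 1`). [folklore] -/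
theorem pow_mul_annulusProfile (hd : 1 ≤ d) {r y : ℝ} (hy : 0 < y) :
    y ^ (d - 1) * annulusProfile d r y = (Ici r).indicator (fun y => y ^ (-2 : ℝ)) y := by
  unfold annulusProfile
  by_cases h : r ≤ y
  · rw [if_pos h, indicator_of_mem (mem_Ici.2 h)]
    have h1 : y ^ (d + 1) = y ^ (d - 1) * y ^ 2 := by rw [← pow_add]; congr 1; omega
    rw [h1, mul_inv, ← mul_assoc, mul_inv_cancel₀ (pow_ne_zero _ hy.ne'), one_mul,
      Real.rpow_neg hy.le, Real.rpow_two]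
  · rw [if_neg h, indicator_of_notMem (fun h' => h (mem_Ici.1 h')), mul_zero]

/-- `y^{d-1} · annulusProfile ∈ L¹(0,∞)` (`r > 0`). [folklore] -/
theorem integrableOn_pow_mul_annulusProfile (hd : 1 ≤ d) {r : ℝ} (hr : 0 < r) :
    IntegrableOn (fun y : ℝ => y ^ (d - 1) * annulusProfile d r y) (Ioi 0) := by
  have h0 : IntegrableOn (fun y : ℝ => y ^ (-2 : ℝ)) (Ici r) :=
    (integrableOn_Ici_iff_integrableOn_Ioi (by simp)).2 (integrableOn_Ioi_rpow_of_lt (by norm_num) hr)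
  have h : IntegrableOn (fun y : ℝ => (Ici r).indicator (fun y => y ^ (-2 : ℝ)) y) (Ioi 0) := by
    rw [IntegrableOn, integrable_indicator_iff measurableSet_Ici, IntegrableOn,
      Measure.restrict_restrict measurableSet_Ici]
    exact h0.mono_set inter_subset_left
  exact h.congr_fun (fun y hy => (pow_mul_annulusProfile hd (mem_Ioi.1 hy)).symm) measurableSet_Ioi

/-- **The annulus**: `∫_{‖k‖ ≥ r} ‖k‖^{-(d+1)} dk = d 2^d / r` (`d ≥ 1`, `r > 0`). [folklore] -/
theorem integral_norm_pow_inv_annulus (hd : 1 ≤ d) {r : ℝ} (hr : 0 < r) :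
    ∫ k : Fin d → ℝ, annulusProfile d r ‖k‖ = d * 2 ^ d * r⁻¹ := by
  rw [integral_fun_norm_pi hd]
  congr 1
  have hsub : Ici r ∩ Ioi 0 = Ici r := inter_eq_left.2 fun y hy => lt_of_lt_of_le hr (mem_Ici.1 hy)
  rw [setIntegral_congr_fun measurableSet_Ioi (fun y hy => pow_mul_annulusProfile hd (mem_Ioi.1 hy)),
    integral_indicator measurableSet_Ici, Measure.restrict_restrict measurableSet_Ici, hsub,
    integral_Ici_eq_integral_Ioi, integral_Ioi_rpow_of_lt (by norm_num) hr]
  rw [show (-2 : ℝ) + 1 = -1 by norm_num, Real.rpow_neg_one]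
  ring

/-- Integrability of the annulus integrand. [folklore] -/
theorem integrable_annulusProfile_norm (hd : 1 ≤ d) {r : ℝ} (hr : 0 < r) :
    Integrable fun k : Fin d → ℝ => annulusProfile d r ‖k‖ :=
  (integrable_fun_norm_pi hd _).2 (integrableOn_pow_mul_annulusProfile hd hr)

/-- The annulus integrand is nonnegative. [folklore] -/
theorem annulusProfile_nonneg (d : ℕ) (r : ℝ) {y : ℝ} (hy : 0 ≤ y) : 0 ≤ annulusProfile d r y := by
  unfold annulusProfile; split_ifs <;> positivity

/-! ## The Dirichlet-kernel majorant `M_L(k) = Π_j π / max(π, L|k_j|)` -/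

/-- The one-dimensional dirichletCutoff `m_L(t) = π / max(π, L|t|)` (`= 1` for `L|t| ≤ π`, `= π/(L|t|)`
beyond). [folklore] -/
def dirichletCutoff (L t : ℝ) : ℝ := π / max π (L * |t|)

/-- `0 < m_L(t)`. [folklore] -/
theorem dirichletCutoff_pos (L t : ℝ) : 0 < dirichletCutoff L t :=
  div_pos pi_pos (lt_of_lt_of_le pi_pos (le_max_left _ _))

/-- `m_L(t) ≤ 1`. [folklore] -/
theorem dirichletCutoff_le_one (L t : ℝ) : dirichletCutoff L t ≤ 1 :=
  (div_le_one (lt_of_lt_of_le pi_pos (le_max_left _ _))).2 (le_max_left _ _)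

/-- `m_L(t) ≤ π/(L|t|)` for `t ≠ 0`, `L > 0`. [folklore] -/
theorem dirichletCutoff_le_div {L t : ℝ} (hL : 0 < L) (ht : t ≠ 0) : dirichletCutoff L t ≤ π / (L * |t|) :=
  div_le_div_of_nonneg_left pi_pos.le (mul_pos hL (abs_pos.2 ht)) (le_max_right _ _)

/-- `m_L(t) = π/(L t)` for `L t ≥ π`, `t > 0`. [folklore] -/
theorem dirichletCutoff_eq_of_le {L t : ℝ} (ht : 0 < t) (h : π ≤ L * t) : dirichletCutoff L t = π / L * t⁻¹ := by
  unfold dirichletCutoff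
  rw [abs_of_pos ht, max_eq_right h]
  field_simp

/-- `m_L` is even. [folklore] -/
theorem dirichletCutoff_neg (L t : ℝ) : dirichletCutoff L (-t) = dirichletCutoff L t := by
  unfold dirichletCutoff; rw [abs_neg]

/-- `m_L` is continuous. [folklore] -/
theorem continuous_dirichletCutoff (L : ℝ) : Continuous (dirichletCutoff L) := by
  unfold dirichletCutoff
  refine continuous_const.div (continuous_const.max (continuous_const.mul continuous_abs)) fun t => ?_
  exact (lt_of_lt_of_le pi_pos (le_max_left _ _)).ne'

/-- **`∫_{-π}^{π} m_L(t) dt ≤ (2π/L)(1 + log L)`** for `L ≥ 1`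
(`= 2[∫_0^{π/L} 1 + ∫_{π/L}^{π} π/(Lt) dt] = (2π/L)(1 + log L)`). [cite: LiuSlade2026, App. B (proof of (3.15): ∫_{1/L}^π t^{-q} dt)] -/
theorem integral_dirichletCutoff_le {L : ℝ} (hL : 1 ≤ L) :
    ∫ t in -π..π, dirichletCutoff L t ≤ 2 * π / L * (1 + Real.log L) := by
  have hL0 : 0 < L := lt_of_lt_of_le one_pos hL
  have hπL : 0 < π / L := div_pos pi_pos hL0
  have hπLπ : π / L ≤ π := div_le_self pi_pos.le hL
  have hint : ∀ a b : ℝ, IntervalIntegrable (dirichletCutoff L) volume a b := fun a b =>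
    (continuous_dirichletCutoff L).intervalIntegrable a b
  -- evenness: `∫_{-π}^{0} = ∫_0^{π}`
  have hneg : ∫ t in -π..0, dirichletCutoff L t = ∫ t in (0 : ℝ)..π, dirichletCutoff L t := by
    have h := intervalIntegral.integral_comp_neg (a := 0) (b := π) (fun t => dirichletCutoff L t)
    simp only [dirichletCutoff_neg, neg_zero] at h
    exact h.symm
  have hsplit : ∫ t in -π..π, dirichletCutoff L t = 2 * ∫ t in (0 : ℝ)..π, dirichletCutoff L t := by
    rw [← intervalIntegral.integral_add_adjacent_intervals (hint (-π) 0) (hint 0 π), hneg]; ring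
  -- `∫_0^{π/L} ≤ π/L`
  have h1 : ∫ t in (0 : ℝ)..π / L, dirichletCutoff L t ≤ π / L := by
    have := intervalIntegral.integral_mono_on hπL.le (hint 0 (π / L)) intervalIntegrable_const
      (fun t _ => dirichletCutoff_le_one L t)
    simpa using this
  -- `∫_{π/L}^{π} = (π/L) log L`
  have h2 : ∫ t in π / L..π, dirichletCutoff L t = π / L * Real.log L := by
    have heq : ∀ t ∈ uIcc (π / L) π, dirichletCutoff L t = π / L * t⁻¹ := by
      intro t ht
      rw [uIcc_of_le hπLπ] at ht
      have ht0 : 0 < t := lt_of_lt_of_le hπL ht.1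
      refine dirichletCutoff_eq_of_le ht0 ?_
      calc π = L * (π / L) := by field_simp
        _ ≤ L * t := mul_le_mul_of_nonneg_left ht.1 hL0.le
    rw [intervalIntegral.integral_congr heq, intervalIntegral.integral_const_mul,
      integral_inv_of_pos hπL pi_pos]
    congr 1
    field_simp
  rw [hsplit, ← intervalIntegral.integral_add_adjacent_intervals (hint 0 (π / L)) (hint (π / L) π), h2]
  have : 2 * (∫ t in (0 : ℝ)..π / L, dirichletCutoff L t) + 2 * (π / L * Real.log L) ≤
      2 * π / L * (1 + Real.log L) := by
    have := mul_le_mul_of_nonneg_left h1 (by norm_num : (0 : ℝ) ≤ 2)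
    have e : 2 * π / L * (1 + Real.log L) = 2 * (π / L) + 2 * (π / L * Real.log L) := by ring
    rw [e]; linarith
  linarith

/-- `0 ≤ ∫_{-π}^{π} m_L`. [folklore] -/
theorem integral_dirichletCutoff_nonneg (L : ℝ) : 0 ≤ ∫ t in -π..π, dirichletCutoff L t :=
  intervalIntegral.integral_nonneg (by linarith [pi_pos]) fun t _ => (dirichletCutoff_pos L t).le

/-- The majorant `M_L(k) = Π_j m_L(k_j)` of `|∂_l^a D̂(k)|/L^a` (Dirichlet kernel with Abel
summation, see `LaceExpansionIsingGreenComparisonSymbols.lean`). [folklore] -/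
def dirichletMajorant (L : ℝ) (k : Fin d → ℝ) : ℝ := ∏ j, dirichletCutoff L (k j)

/-- `0 < M_L(k)`. [folklore] -/
theorem dirichletMajorant_pos (L : ℝ) (k : Fin d → ℝ) : 0 < dirichletMajorant L k :=
  Finset.prod_pos fun j _ => dirichletCutoff_pos L (k j)

/-- `M_L(k) ≤ 1`. [folklore] -/
theorem dirichletMajorant_le_one (L : ℝ) (k : Fin d → ℝ) : dirichletMajorant L k ≤ 1 :=
  Finset.prod_le_one (fun j _ => (dirichletCutoff_pos L (k j)).le) fun j _ => dirichletCutoff_le_one L (k j)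

/-- `M_L` is continuous. [folklore] -/
theorem continuous_dirichletMajorant (L : ℝ) : Continuous (dirichletMajorant L : (Fin d → ℝ) → ℝ) :=
  continuous_finsetProd _ fun j _ => (continuous_dirichletCutoff L).comp (continuous_apply j)

/-- Dropping a factor: `M_L(k) ≤ m_L(k_j)`. [folklore] -/
theorem dirichletMajorant_le_dirichletCutoff (L : ℝ) (k : Fin d → ℝ) (j : Fin d) : dirichletMajorant L k ≤ dirichletCutoff L (k j) := by
  unfold dirichletMajorant
  rw [← Finset.mul_prod_erase Finset.univ _ (Finset.mem_univ j)]
  refine mul_le_of_le_one_right (dirichletCutoff_pos L (k j)).le ?_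
  exact Finset.prod_le_one (fun i _ => (dirichletCutoff_pos L (k i)).le) fun i _ => dirichletCutoff_le_one L (k i)

/-- **`∫_{[-π,π]^d} M_L(k) dk ≤ ((2π/L)(1 + log L))^d`** for `L ≥ 1` (Fubini for the product).
[cite: LiuSlade2026, App. B (proof of (3.15))] -/
theorem integral_cube_dirichletMajorant_le {L : ℝ} (hL : 1 ≤ L) :
    ∫ k in Set.pi Set.univ (fun _ : Fin d => Icc (-π) π), dirichletMajorant L k ≤
      (2 * π / L * (1 + Real.log L)) ^ d := by
  have hprod : ∫ k in Set.pi Set.univ (fun _ : Fin d => Icc (-π) π), dirichletMajorant L k =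
      ∏ _j : Fin d, ∫ t in Icc (-π) π, dirichletCutoff L t := by
    rw [volume_pi, Measure.restrict_pi_pi]
    exact integral_fintype_prod_eq_prod (fun (_ : Fin d) (t : ℝ) => dirichletCutoff L t)
  rw [hprod, Finset.prod_const, Finset.card_univ, Fintype.card_fin]
  have h1 : ∫ t in Icc (-π) π, dirichletCutoff L t = ∫ t in -π..π, dirichletCutoff L t := by
    rw [intervalIntegral.integral_of_le (by linarith [pi_pos]), integral_Icc_eq_integral_Ioc]
  rw [h1]
  exact pow_le_pow_left₀ (integral_dirichletCutoff_nonneg L) (integral_dirichletCutoff_le hL) d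

/-- `M_L` is integrable on the cube. [folklore] -/
theorem integrableOn_dirichletMajorant (L : ℝ) :
    IntegrableOn (dirichletMajorant L) (Set.pi Set.univ (fun _ : Fin d => Icc (-π) π)) volume :=
  (continuous_dirichletMajorant L).continuousOn.integrableOn_compact
    (isCompact_univ_pi fun _ => isCompact_Icc)

end Literature.Barriers.CriticalPhenomena

end
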